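import Summits.ResolutionOfSingularities.ResolutionOfSingularities.Theorems.FrobeniusLadderFRationalResolutionGaloisTwistStabilizer
import Summits.ResolutionOfSingularities.ResolutionOfSingularities.Theorems.FrobeniusLadderFRationalResolutionGaloisChartTransitive
import HarnessLib

/-!
# Crux `FrobeniusLadder.FRationalResolution` (stmt-ResolutionOfSingularities-15317), line `redirect`,
# stub `stub_diagonalizableQuotientResolution` — TRANSPORT OF PIECES between chart points: `σ''(𝔚₁) = 𝔚₂ ⇒ (1 ⊗ σ) I₁ = I₂`
# (the pieces descended through the trivial-residue points over `𝔔'` form ONE orbit under the decomposition group)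

Setting of the Galois route (`…GaloisTwistChart`, `…GaloisUpstairsPieceCover`, `…GaloisTwistStabilizer`): `B' = B ⊗_K K'` with
twists `1 ⊗ σ`, a flat chart `C` over `B`, `C' = B' ⊗_B C` with chart twists `σ'' = (1 ⊗ σ) ⊗ 1`, `𝔔' ⊆ B'` maximal, a chart
centre `J ⊆ C`. A PIECE AT A CHART POINT `𝔚` over `𝔔'` is a `𝔔'`-coprimary ideal `I ⊆ B'` with the chart equation
`I C'_G = J C'_G` for some `G ∉ 𝔚` (the output of `…GaloisUpstairsPieceCover.exists_piece_cover`).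

* **`map_twist_eq_of_map_chartTwist_eq`** — if `I₁` is a piece at `𝔚₁`, `I₂` a piece at `𝔚₂`, and `σ''(𝔚₁) = 𝔚₂`, then
  `(1 ⊗ σ) I₁ = I₂` EXACTLY. (Generalises ✓ `…GaloisTwistStabilizer.map_twist_eq_self_of_map_chartTwist_eq`, the case `𝔚₁ = 𝔚₂`,
  `I₁ = I₂`.) Proof: `σ` lies in the decomposition group (`𝔚ᵢ ∩ B' = 𝔔'`); transporting `I₁ C'_{G₁} = J C'_{G₁}` along `σ''`
  (which fixes `J C'`) gives `((1 ⊗ σ) I₁) T = J T = I₂ T` in `T = C'_{G₂ σ''G₁}`, a flat `B'`-algebra with the point `𝔚₂ T` over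
  `𝔔'`; coprimary ideals with equal extensions to such an algebra are equal (✓ `…GaloisTwistStabilizer.le_of_map_le_of_flat_of_pow_le`).
* `piece_eq_of_point_eq` — in particular the piece at a chart point is UNIQUE (two pieces at the same point coincide).
* **`exists_decomposition_map_twist_eq`** — for `K'/K` finite Galois: pieces at two chart points over `𝔔'` and over the same point
  of `C` differ by a twist `1 ⊗ σ` with `σ` in the DECOMPOSITION GROUP of `𝔔'` (✓ `…GaloisChartTransitive.exists_decomposition_map_chartTwist_eq`
  supplies `σ` with `σ''(𝔚₁) = 𝔚₂`).

Consequence for the route (memo MEMO-15317-leafhand2-g14 §2–3): together with the transitivity of the decomposition group `D` on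
the chart points over `(𝔔, 𝔔')` (file `…GaloisChartTransitive`), the set of pieces through the trivial-residue points over `𝔔'` is
ONE `D`-orbit `{(1 ⊗ τ) I₁ : τ ∈ D}`; the decomposition-stability obligation `hD` of `…GaloisBaseChangeRegular` for `I₁` is
therefore EQUIVALENT to «the piece does not depend on the trivial-residue point», and the symmetrized piece of
`…GaloisSymmetrizedPiece` is the product of the pieces at all points (each to the power `|Stab|`), an intrinsic ideal.

Honest label: plumbing/structure toward ONE leaf stub (no stub, crux or summit closed). No definitions, no named facts, no sorry.
[cite: StacksProject, Tag 09EB; Tag 00HP]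
-/

noncomputable section

-- single-problem summit: the doubled namespace component is forced
set_option linter.dupNamespace false

open scoped TensorProduct

namespace Summit.ResolutionOfSingularities.ResolutionOfSingularities.Theorems.FRationalResolution.GaloisPieceOrbit

set_option maxHeartbeats 1600000 in
/-- **`σ''(𝔚₁) = 𝔚₂ ⇒ (1 ⊗ σ) I₁ = I₂`.** Data: `B' = B ⊗_K K'`, `C` a flat `B`-algebra, `C' = B' ⊗_B C`; `𝔔' ⊆ B'` maximal;
ideals `I₁ ⊇ 𝔔'^{n₁}`, `I₂ ⊇ 𝔔'^{n₂}` of `B'`; ideals `𝔚₁, 𝔚₂ ⊆ C'` over `𝔔'` (`𝔚₂` prime); `Gᵢ ∉ 𝔚ᵢ` with the chart equations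
`Iᵢ C'_{Gᵢ} = J C'_{Gᵢ}` for one ideal `J ⊆ C`; and `σ ∈ Aut_K(K')` whose chart twist carries `𝔚₁` to `𝔚₂`. Then
`(1 ⊗ σ) I₁ = I₂`. [cite: StacksProject, Tag 09EB; Tag 00HP] -/
theorem map_twist_eq_of_map_chartTwist_eq {K B K' C : Type} [Field K] [CommRing B] [Algebra K B] [Field K']
    [Algebra K K'] [CommRing C] [Algebra B C] [Module.Flat B C]
    (𝔔' : Ideal (B ⊗[K] K')) [𝔔'.IsMaximal] (I₁ I₂ : Ideal (B ⊗[K] K')) {n₁ n₂ : ℕ} (hn₁ : 𝔔' ^ n₁ ≤ I₁)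
    (hn₂ : 𝔔' ^ n₂ ≤ I₂) (J : Ideal C)
    (𝔚₁ 𝔚₂ : Ideal ((B ⊗[K] K') ⊗[B] C)) [h𝔚₂ : 𝔚₂.IsPrime]
    (h𝔚₁B : 𝔚₁.comap (algebraMap (B ⊗[K] K') ((B ⊗[K] K') ⊗[B] C)) = 𝔔')
    (h𝔚₂B : 𝔚₂.comap (algebraMap (B ⊗[K] K') ((B ⊗[K] K') ⊗[B] C)) = 𝔔')
    (G₁ : (B ⊗[K] K') ⊗[B] C) (hG₁ : G₁ ∉ 𝔚₁)
    (hIJ₁ : I₁.map (algebraMap (B ⊗[K] K') (Localization.Away G₁)) =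
      (J.map ((Algebra.TensorProduct.includeRight : C →ₐ[B] (B ⊗[K] K') ⊗[B] C) : C →+* (B ⊗[K] K') ⊗[B] C)).map
        (algebraMap ((B ⊗[K] K') ⊗[B] C) (Localization.Away G₁)))
    (G₂ : (B ⊗[K] K') ⊗[B] C) (hG₂ : G₂ ∉ 𝔚₂)
    (hIJ₂ : I₂.map (algebraMap (B ⊗[K] K') (Localization.Away G₂)) =
      (J.map ((Algebra.TensorProduct.includeRight : C →ₐ[B] (B ⊗[K] K') ⊗[B] C) : C →+* (B ⊗[K] K') ⊗[B] C)).map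
        (algebraMap ((B ⊗[K] K') ⊗[B] C) (Localization.Away G₂)))
    (σ : K' ≃ₐ[K] K')
    (hσ𝔚 : 𝔚₁.map (Algebra.TensorProduct.map (Algebra.TensorProduct.map (AlgHom.id B B) (σ : K' →ₐ[K] K'))
      (AlgHom.id B C)) = 𝔚₂) :
    I₁.map (Algebra.TensorProduct.map (AlgHom.id B B) (σ : K' →ₐ[K] K')) = I₂ := by
  -- opaque names for the twists and the structure maps (keeps definitional unfolding cheap)
  obtain ⟨tw, htw⟩ : ∃ tw : B ⊗[K] K' →ₐ[B] B ⊗[K] K',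
      tw = Algebra.TensorProduct.map (AlgHom.id B B) (σ : K' →ₐ[K] K') := ⟨_, rfl⟩
  obtain ⟨Tw, hTw⟩ : ∃ Tw : (B ⊗[K] K') ⊗[B] C →ₐ[B] (B ⊗[K] K') ⊗[B] C,
      Tw = Algebra.TensorProduct.map (Algebra.TensorProduct.map (AlgHom.id B B) (σ : K' →ₐ[K] K')) (AlgHom.id B C) :=
    ⟨_, rfl⟩
  obtain ⟨iR, hiR⟩ : ∃ iR : C →+* (B ⊗[K] K') ⊗[B] C,
      iR = ((Algebra.TensorProduct.includeRight : C →ₐ[B] (B ⊗[K] K') ⊗[B] C) : C →+* (B ⊗[K] K') ⊗[B] C) :=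
    ⟨_, rfl⟩
  rw [← htw]
  rw [← hTw] at hσ𝔚
  rw [← hiR] at hIJ₁ hIJ₂
  set iB : B ⊗[K] K' →+* (B ⊗[K] K') ⊗[B] C := algebraMap (B ⊗[K] K') ((B ⊗[K] K') ⊗[B] C) with hiB
  -- `σ` lies in the decomposition group of `𝔔'`
  have hσ : 𝔔'.map tw = 𝔔' := by
    have h := GaloisTwistChart.comap_algebraMap_map_chartTwist (B := B) (C := C) σ 𝔚₁
    rw [← hTw, ← htw, hσ𝔚, ← hiB, h𝔚₂B, h𝔚₁B] at h
    exact h.symm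
  -- the chart-twist identities (from `…GaloisTwistChart`), in the opaque names
  have hA : (I₁.map iB).map (Tw : (B ⊗[K] K') ⊗[B] C →+* (B ⊗[K] K') ⊗[B] C) = (I₁.map tw).map iB := by
    have h := GaloisTwistChart.map_chartTwist_map_algebraMap (B := B) (C := C) σ I₁
    rw [← hTw, ← htw, ← hiB] at h
    exact h
  have hB : (J.map iR).map (Tw : (B ⊗[K] K') ⊗[B] C →+* (B ⊗[K] K') ⊗[B] C) = J.map iR := by
    have h := GaloisTwistChart.map_chartTwist_map_includeRight (B := B) (K := K) (K' := K') (C := C) σ J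
    rw [← hTw, ← hiR] at h
    exact h
  have hTwinv : ∀ x, Algebra.TensorProduct.map
      (Algebra.TensorProduct.map (AlgHom.id B B) ((σ⁻¹ : K' ≃ₐ[K] K') : K' →ₐ[K] K')) (AlgHom.id B C) (Tw x) = x := by
    intro x
    rw [hTw]
    exact GaloisTwistChart.chartTwist_inv_apply (B := B) (C := C) σ x
  have hTwG : Tw G₁ ∉ 𝔚₂ := by
    intro hmem
    apply hG₁
    have h2 : Tw G₁ ∈ 𝔚₁.map Tw := by rw [hσ𝔚]; exact hmem
    rw [hTw, ← GaloisTwistChart.comap_chartTwist_inv_eq_map, Ideal.mem_comap, ← hTw, hTwinv] at h2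
    exact h2
  -- the localization `T = C'_{G₂ σ''G₁}` and its point over `𝔔'`
  have hdisj : Disjoint ((Submonoid.powers (G₂ * Tw G₁) : Submonoid ((B ⊗[K] K') ⊗[B] C)) : Set ((B ⊗[K] K') ⊗[B] C))
      (𝔚₂ : Set ((B ⊗[K] K') ⊗[B] C)) := by
    refine Set.disjoint_left.mpr ?_
    rintro x ⟨m, rfl⟩ hx
    have hx' : G₂ ^ m * Tw G₁ ^ m ∈ 𝔚₂ := by rw [← mul_pow]; exact hx
    rcases h𝔚₂.mem_or_mem hx' with h | h
    · exact hG₂ (h𝔚₂.mem_of_pow_mem m h)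
    · exact hTwG (h𝔚₂.mem_of_pow_mem m h)
  set P : Ideal (Localization.Away (algebraMap ((B ⊗[K] K') ⊗[B] C) (Localization.Away G₂) (Tw G₁))) :=
    𝔚₂.map (algebraMap ((B ⊗[K] K') ⊗[B] C)
      (Localization.Away (algebraMap ((B ⊗[K] K') ⊗[B] C) (Localization.Away G₂) (Tw G₁)))) with hPdef
  haveI hPprime : P.IsPrime :=
    IsLocalization.isPrime_of_isPrime_disjoint (Submonoid.powers (G₂ * Tw G₁))
      (Localization.Away (algebraMap ((B ⊗[K] K') ⊗[B] C) (Localization.Away G₂) (Tw G₁))) 𝔚₂ h𝔚₂ hdisj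
  have hPc : P.comap (algebraMap ((B ⊗[K] K') ⊗[B] C)
      (Localization.Away (algebraMap ((B ⊗[K] K') ⊗[B] C) (Localization.Away G₂) (Tw G₁)))) = 𝔚₂ :=
    IsLocalization.under_map_of_isPrime_disjoint (Submonoid.powers (G₂ * Tw G₁))
      (Localization.Away (algebraMap ((B ⊗[K] K') ⊗[B] C) (Localization.Away G₂) (Tw G₁))) h𝔚₂ hdisj
  have hPB : P.comap (algebraMap (B ⊗[K] K')
      (Localization.Away (algebraMap ((B ⊗[K] K') ⊗[B] C) (Localization.Away G₂) (Tw G₁)))) = 𝔔' := by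
    rw [IsScalarTower.algebraMap_eq (B ⊗[K] K') ((B ⊗[K] K') ⊗[B] C)
        (Localization.Away (algebraMap ((B ⊗[K] K') ⊗[B] C) (Localization.Away G₂) (Tw G₁))),
      ← Ideal.comap_comap, hPc, ← hiB, h𝔚₂B]
  -- (i) `I₂ C'_{G₂} = J C'_{G₂}`, pushed to `T`
  have hI₂T : I₂.map (algebraMap (B ⊗[K] K')
      (Localization.Away (algebraMap ((B ⊗[K] K') ⊗[B] C) (Localization.Away G₂) (Tw G₁)))) =
      (J.map iR).map (algebraMap ((B ⊗[K] K') ⊗[B] C)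
        (Localization.Away (algebraMap ((B ⊗[K] K') ⊗[B] C) (Localization.Away G₂) (Tw G₁)))) := by
    rw [IsScalarTower.algebraMap_eq (B ⊗[K] K') (Localization.Away G₂)
        (Localization.Away (algebraMap ((B ⊗[K] K') ⊗[B] C) (Localization.Away G₂) (Tw G₁))),
      ← Ideal.map_map, hIJ₂, Ideal.map_map,
      ← IsScalarTower.algebraMap_eq ((B ⊗[K] K') ⊗[B] C) (Localization.Away G₂)
        (Localization.Away (algebraMap ((B ⊗[K] K') ⊗[B] C) (Localization.Away G₂) (Tw G₁)))]
  -- (ii) `((1 ⊗ σ) I₁) T = σ''(I₁ C') T = J T`, transporting `I₁ C'_{G₁} = J C'_{G₁}` along `σ''`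
  have hI₁L : (I₁.map iB).map (algebraMap ((B ⊗[K] K') ⊗[B] C) (Localization.Away G₁)) =
      (J.map iR).map (algebraMap ((B ⊗[K] K') ⊗[B] C) (Localization.Away G₁)) := by
    rw [hiB, Ideal.map_map, ← IsScalarTower.algebraMap_eq (B ⊗[K] K') ((B ⊗[K] K') ⊗[B] C) (Localization.Away G₁)]
    exact hIJ₁
  have hunit : IsUnit (((algebraMap ((B ⊗[K] K') ⊗[B] C)
      (Localization.Away (algebraMap ((B ⊗[K] K') ⊗[B] C) (Localization.Away G₂) (Tw G₁)))).comp
      (Tw : (B ⊗[K] K') ⊗[B] C →+* (B ⊗[K] K') ⊗[B] C)) G₁) := by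
    rw [RingHom.comp_apply, IsScalarTower.algebraMap_apply ((B ⊗[K] K') ⊗[B] C) (Localization.Away G₂)
      (Localization.Away (algebraMap ((B ⊗[K] K') ⊗[B] C) (Localization.Away G₂) (Tw G₁)))]
    exact IsLocalization.Away.algebraMap_isUnit (algebraMap ((B ⊗[K] K') ⊗[B] C) (Localization.Away G₂) (Tw G₁))
  obtain ⟨μ, hμc⟩ : ∃ μ : (Localization.Away G₁) →+*
      (Localization.Away (algebraMap ((B ⊗[K] K') ⊗[B] C) (Localization.Away G₂) (Tw G₁))),
      μ.comp (algebraMap ((B ⊗[K] K') ⊗[B] C) (Localization.Away G₁)) =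
        (algebraMap ((B ⊗[K] K') ⊗[B] C)
          (Localization.Away (algebraMap ((B ⊗[K] K') ⊗[B] C) (Localization.Away G₂) (Tw G₁)))).comp
          (Tw : (B ⊗[K] K') ⊗[B] C →+* (B ⊗[K] K') ⊗[B] C) :=
    ⟨IsLocalization.Away.lift G₁ hunit, IsLocalization.Away.lift_comp G₁ hunit⟩
  have h1 : (I₁.map tw).map (algebraMap (B ⊗[K] K')
      (Localization.Away (algebraMap ((B ⊗[K] K') ⊗[B] C) (Localization.Away G₂) (Tw G₁)))) =
      ((I₁.map tw).map iB).map (algebraMap ((B ⊗[K] K') ⊗[B] C)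
        (Localization.Away (algebraMap ((B ⊗[K] K') ⊗[B] C) (Localization.Away G₂) (Tw G₁)))) := by
    rw [hiB, Ideal.map_map, ← IsScalarTower.algebraMap_eq (B ⊗[K] K') ((B ⊗[K] K') ⊗[B] C)
      (Localization.Away (algebraMap ((B ⊗[K] K') ⊗[B] C) (Localization.Away G₂) (Tw G₁)))]
  have h2 : ((I₁.map iB).map (Tw : (B ⊗[K] K') ⊗[B] C →+* (B ⊗[K] K') ⊗[B] C)).map
      (algebraMap ((B ⊗[K] K') ⊗[B] C)
        (Localization.Away (algebraMap ((B ⊗[K] K') ⊗[B] C) (Localization.Away G₂) (Tw G₁)))) =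
      ((I₁.map iB).map (algebraMap ((B ⊗[K] K') ⊗[B] C) (Localization.Away G₁))).map μ := by
    rw [Ideal.map_map (Tw : (B ⊗[K] K') ⊗[B] C →+* (B ⊗[K] K') ⊗[B] C) (algebraMap ((B ⊗[K] K') ⊗[B] C)
        (Localization.Away (algebraMap ((B ⊗[K] K') ⊗[B] C) (Localization.Away G₂) (Tw G₁)))),
      Ideal.map_map (algebraMap ((B ⊗[K] K') ⊗[B] C) (Localization.Away G₁)) μ, hμc]
  have h3 : ((J.map iR).map (algebraMap ((B ⊗[K] K') ⊗[B] C) (Localization.Away G₁))).map μ =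
      ((J.map iR).map (Tw : (B ⊗[K] K') ⊗[B] C →+* (B ⊗[K] K') ⊗[B] C)).map
        (algebraMap ((B ⊗[K] K') ⊗[B] C)
          (Localization.Away (algebraMap ((B ⊗[K] K') ⊗[B] C) (Localization.Away G₂) (Tw G₁)))) := by
    rw [Ideal.map_map (Tw : (B ⊗[K] K') ⊗[B] C →+* (B ⊗[K] K') ⊗[B] C) (algebraMap ((B ⊗[K] K') ⊗[B] C)
        (Localization.Away (algebraMap ((B ⊗[K] K') ⊗[B] C) (Localization.Away G₂) (Tw G₁)))),
      Ideal.map_map (algebraMap ((B ⊗[K] K') ⊗[B] C) (Localization.Away G₁)) μ, hμc]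
  have htwT : (I₁.map tw).map (algebraMap (B ⊗[K] K')
      (Localization.Away (algebraMap ((B ⊗[K] K') ⊗[B] C) (Localization.Away G₂) (Tw G₁)))) =
      (J.map iR).map (algebraMap ((B ⊗[K] K') ⊗[B] C)
        (Localization.Away (algebraMap ((B ⊗[K] K') ⊗[B] C) (Localization.Away G₂) (Tw G₁)))) :=
    h1.trans <| ((congrArg (Ideal.map (algebraMap ((B ⊗[K] K') ⊗[B] C)
      (Localization.Away (algebraMap ((B ⊗[K] K') ⊗[B] C) (Localization.Away G₂) (Tw G₁))))) hA).symm.trans <|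
      h2.trans <| (congrArg (Ideal.map μ) hI₁L).trans <| h3.trans <|
        congrArg (Ideal.map (algebraMap ((B ⊗[K] K') ⊗[B] C)
          (Localization.Away (algebraMap ((B ⊗[K] K') ⊗[B] C) (Localization.Away G₂) (Tw G₁))))) hB)
  -- (iii) descend along the flat `B' → T` with its point `P` over `𝔔'`
  have hntw : 𝔔' ^ n₁ ≤ I₁.map tw := by
    calc 𝔔' ^ n₁ = (𝔔'.map tw) ^ n₁ := by rw [hσ]
      _ = (𝔔' ^ n₁).map tw := (Ideal.map_pow tw 𝔔' n₁).symm
      _ ≤ I₁.map tw := Ideal.map_mono hn₁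
  exact le_antisymm
    (GaloisTwistStabilizer.le_of_map_le_of_flat_of_pow_le 𝔔' P hPB (I₁.map tw) I₂ hn₂ (htwT.trans hI₂T.symm).le)
    (GaloisTwistStabilizer.le_of_map_le_of_flat_of_pow_le 𝔔' P hPB I₂ (I₁.map tw) hntw (htwT.trans hI₂T.symm).ge)

/-- **The piece at a chart point is unique.** Two `𝔔'`-coprimary ideals `I₁, I₂ ⊆ B'` satisfying chart equations
`Iᵢ C'_{Gᵢ} = J C'_{Gᵢ}` (`Gᵢ ∉ 𝔚`) at the SAME prime `𝔚` over `𝔔'` coincide. [cite: StacksProject, Tag 00HP] -/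
theorem piece_eq_of_point_eq {K B K' C : Type} [Field K] [CommRing B] [Algebra K B] [Field K']
    [Algebra K K'] [CommRing C] [Algebra B C] [Module.Flat B C]
    (𝔔' : Ideal (B ⊗[K] K')) [𝔔'.IsMaximal] (I₁ I₂ : Ideal (B ⊗[K] K')) {n₁ n₂ : ℕ} (hn₁ : 𝔔' ^ n₁ ≤ I₁)
    (hn₂ : 𝔔' ^ n₂ ≤ I₂) (J : Ideal C)
    (𝔚 : Ideal ((B ⊗[K] K') ⊗[B] C)) [𝔚.IsPrime]
    (h𝔚B : 𝔚.comap (algebraMap (B ⊗[K] K') ((B ⊗[K] K') ⊗[B] C)) = 𝔔')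
    (G₁ : (B ⊗[K] K') ⊗[B] C) (hG₁ : G₁ ∉ 𝔚)
    (hIJ₁ : I₁.map (algebraMap (B ⊗[K] K') (Localization.Away G₁)) =
      (J.map ((Algebra.TensorProduct.includeRight : C →ₐ[B] (B ⊗[K] K') ⊗[B] C) : C →+* (B ⊗[K] K') ⊗[B] C)).map
        (algebraMap ((B ⊗[K] K') ⊗[B] C) (Localization.Away G₁)))
    (G₂ : (B ⊗[K] K') ⊗[B] C) (hG₂ : G₂ ∉ 𝔚)
    (hIJ₂ : I₂.map (algebraMap (B ⊗[K] K') (Localization.Away G₂)) =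
      (J.map ((Algebra.TensorProduct.includeRight : C →ₐ[B] (B ⊗[K] K') ⊗[B] C) : C →+* (B ⊗[K] K') ⊗[B] C)).map
        (algebraMap ((B ⊗[K] K') ⊗[B] C) (Localization.Away G₂))) :
    I₁ = I₂ := by
  have h := map_twist_eq_of_map_chartTwist_eq 𝔔' I₁ I₂ hn₁ hn₂ J 𝔚 𝔚 h𝔚B h𝔚B G₁ hG₁ hIJ₁ G₂ hG₂ hIJ₂ 1
    (by rw [GaloisTwistChart.chartTwist_one]; exact Ideal.map_id _)
  rw [GaloisSymmetrizedPiece.twist_one] at h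
  exact (Ideal.map_id _).symm.trans h

/-- **The pieces over `𝔔'` form ONE orbit under the decomposition group.** `K'/K` finite Galois, `C` flat over `B`; `I₁` a
piece at the prime `𝔚₁`, `I₂` a piece at the prime `𝔚₂`, both primes of the chart lying over `𝔔' ⊆ B ⊗_K K'` and over the same
prime of `C`. Then `(1 ⊗ σ) 𝔔' = 𝔔'` and `(1 ⊗ σ) I₁ = I₂` for some `σ ∈ Aut_K(K')`. [cite: StacksProject, Tag 09EB; Tag 0CDQ; Tag 00HP] -/
theorem exists_decomposition_map_twist_eq {K B K' C : Type} [Field K] [CommRing B] [Algebra K B] [Field K']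
    [Algebra K K'] [FiniteDimensional K K'] [IsGalois K K'] [CommRing C] [Algebra B C] [Module.Flat B C]
    (𝔔' : Ideal (B ⊗[K] K')) [𝔔'.IsMaximal] (I₁ I₂ : Ideal (B ⊗[K] K')) {n₁ n₂ : ℕ} (hn₁ : 𝔔' ^ n₁ ≤ I₁)
    (hn₂ : 𝔔' ^ n₂ ≤ I₂) (J : Ideal C)
    (𝔚₁ 𝔚₂ : Ideal ((B ⊗[K] K') ⊗[B] C)) [𝔚₁.IsPrime] [𝔚₂.IsPrime]
    (h𝔚₁B : 𝔚₁.comap (algebraMap (B ⊗[K] K') ((B ⊗[K] K') ⊗[B] C)) = 𝔔')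
    (h𝔚₂B : 𝔚₂.comap (algebraMap (B ⊗[K] K') ((B ⊗[K] K') ⊗[B] C)) = 𝔔')
    (h𝔚C : 𝔚₁.comap ((Algebra.TensorProduct.includeRight : C →ₐ[B] (B ⊗[K] K') ⊗[B] C) : C →+* (B ⊗[K] K') ⊗[B] C) =
      𝔚₂.comap ((Algebra.TensorProduct.includeRight : C →ₐ[B] (B ⊗[K] K') ⊗[B] C) : C →+* (B ⊗[K] K') ⊗[B] C))
    (G₁ : (B ⊗[K] K') ⊗[B] C) (hG₁ : G₁ ∉ 𝔚₁)
    (hIJ₁ : I₁.map (algebraMap (B ⊗[K] K') (Localization.Away G₁)) =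
      (J.map ((Algebra.TensorProduct.includeRight : C →ₐ[B] (B ⊗[K] K') ⊗[B] C) : C →+* (B ⊗[K] K') ⊗[B] C)).map
        (algebraMap ((B ⊗[K] K') ⊗[B] C) (Localization.Away G₁)))
    (G₂ : (B ⊗[K] K') ⊗[B] C) (hG₂ : G₂ ∉ 𝔚₂)
    (hIJ₂ : I₂.map (algebraMap (B ⊗[K] K') (Localization.Away G₂)) =
      (J.map ((Algebra.TensorProduct.includeRight : C →ₐ[B] (B ⊗[K] K') ⊗[B] C) : C →+* (B ⊗[K] K') ⊗[B] C)).map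
        (algebraMap ((B ⊗[K] K') ⊗[B] C) (Localization.Away G₂))) :
    ∃ σ : K' ≃ₐ[K] K',
      𝔔'.map (Algebra.TensorProduct.map (AlgHom.id B B) (σ : K' →ₐ[K] K')) = 𝔔' ∧
      I₁.map (Algebra.TensorProduct.map (AlgHom.id B B) (σ : K' →ₐ[K] K')) = I₂ := by
  obtain ⟨σ, hσD, hσ𝔚⟩ :=
    GaloisChartTransitive.exists_decomposition_map_chartTwist_eq 𝔔' 𝔚₁ 𝔚₂ h𝔚₁B h𝔚₂B h𝔚C
  exact ⟨σ, hσD, map_twist_eq_of_map_chartTwist_eq 𝔔' I₁ I₂ hn₁ hn₂ J 𝔚₁ 𝔚₂ h𝔚₁B h𝔚₂B G₁ hG₁ hIJ₁ G₂ hG₂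
    hIJ₂ σ hσ𝔚.symm⟩

end Summit.ResolutionOfSingularities.ResolutionOfSingularities.Theorems.FRationalResolution.GaloisPieceOrbit

end
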